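import Literature.Geometry.Riemannian.WassersteinW1Triangle
import HarnessLib

/-!
# The Gromov–`W₁`–Wasserstein distance between metric measure spaces (Bamler 2023, §2.4)

R. Bamler, *Compactness theory of the space of super Ricci flows*, Invent. Math. 233 (2023), §2.4,
Definition (Gromov–`W_p`–Wasserstein distance): *"Consider two metric measure spaces
`(X₁, d₁, μ₁)`, `(X₂, d₂, μ₂)`. We define the Gromov–`W_p`–Wasserstein distance for any `p ≥ 1`
as `d_{GW_p}((X₁, d₁, μ₁), (X₂, d₂, μ₂)) := inf d^Z_{W_p}((φ₁)_* μ₁, (φ₂)_* μ₂)`, where the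
infimum is taken over all isometric embeddings `φᵢ : (Xᵢ, dᵢ) → (Z, d_Z)` into some common
metric space `(Z, d_Z)`"*; *"In this paper we will mainly work with the Gromov–`W₁`–Wasserstein
distance, as it is best suited for Ricci flows."* It is the distance in which time-slices of
metric flows are compared (§4.2–4.4) and the building block of the `𝔽`-distance (§5).

This file defines `gromovW1 μ ν` for measures `μ` on `X` and `ν` on `Y` (metric spaces in a
common universe `u`), verbatim: the infimum, over all metric spaces `Z : Type u` (with their Borel
σ-algebra) and all pairs of isometric embeddings `φ : X → Z`, `ψ : Y → Z`, of the tree's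
`wassersteinW1 (φ_* μ) (ψ_* ν)` (`MetricFlowConcentration.lean`, the coupling definition of
`d_{W₁}`, valued in `[0, ∞]`). (Restricting `Z` to one universe is harmless: every admissible
configuration can be moved into `ℓ^∞` over the separable closure of the two images by a Kuratowski
embedding; this is not needed below and not proved here.) Proved API:

* `gromovW1_le_wassersteinW1_map` — every concrete pair of embeddings bounds `d_{GW₁}`; in
  particular `gromovW1_le_wassersteinW1` (`Z = X = Y`);
* `gromovW1_comm` — symmetry;
* `gromovW1_self` — `d_{GW₁}((X, μ), (X, μ)) = 0` for a probability measure;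
* `gromovW1_le_gromovW1_map`, `gromovW1_map_isometryEquiv` — monotonicity under isometric
  embeddings of `X` and invariance under isometries of metric measure spaces (Bamler 2023, §2.3:
  isometric metric measure spaces).

What is NOT here: the triangle inequality and `d_{GW₁} = 0 ⇔` isometric supports (Bamler 2023,
§2.4, Proposition after the Definition; needs the gluing of embeddings, Lemma (combining isometric
embeddings)), completeness of `(𝕄, d_{GW₁})`.

## References

* R. H. Bamler, *Compactness theory of the space of super Ricci flows*, Invent. Math. 233 (2023),
  §2.3 (metric measure spaces, isometries), §2.4, Definition (Gromov–`W_p`–Wasserstein distance).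
  [Bamler2023]
* K.-T. Sturm, *On the geometry of metric measure spaces I*, Acta Math. 196 (2006), Def. 3.2
  (the `𝐃`-distance, `p = 2`). [Sturm2006]
-/

noncomputable section

open Set MeasureTheory Filter
open scoped Topology ENNReal NNReal

namespace Literature.Geometry.Riemannian

universe u

section Def

variable {X Y : Type u} [MetricSpace X] [MeasurableSpace X] [MetricSpace Y] [MeasurableSpace Y]

/-- **The Gromov–`W₁`–Wasserstein distance** between the metric measure spaces `(X, d_X, μ)` and
`(Y, d_Y, ν)` (Bamler 2023, §2.4, Definition, `p = 1`):
`d_{GW₁} := inf_{Z, φ, ψ} d^Z_{W₁}(φ_* μ, ψ_* ν)` over all metric spaces `Z` (here: in the universe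
of `X` and `Y`, with the Borel σ-algebra) and all isometric embeddings `φ : X → Z`, `ψ : Y → Z`;
valued in `[0, ∞]`. [cite: Bamler2023, §2.4, Definition (Gromov–W_p–Wasserstein distance)] -/
def gromovW1 (μ : Measure X) (ν : Measure Y) : ℝ≥0∞ :=
  ⨅ (Z : Type u) (_ : MetricSpace Z) (φ : X → Z) (ψ : Y → Z) (_ : Isometry φ) (_ : Isometry ψ),
    @wassersteinW1 Z _ (borel Z) (@Measure.map X Z _ (borel Z) φ μ) (@Measure.map Y Z _ (borel Z) ψ ν)

/-- **Every pair of isometric embeddings into a common metric space bounds `d_{GW₁}`**: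
`d_{GW₁}((X, μ), (Y, ν)) ≤ d^Z_{W₁}(φ_* μ, ψ_* ν)` (the infimum of the Definition).
[cite: Bamler2023, §2.4, Definition (Gromov–W_p–Wasserstein distance)] -/
theorem gromovW1_le_wassersteinW1_map (μ : Measure X) (ν : Measure Y) {Z : Type u} [MetricSpace Z]
    [MeasurableSpace Z] [BorelSpace Z] {φ : X → Z} {ψ : Y → Z} (hφ : Isometry φ)
    (hψ : Isometry ψ) : gromovW1 μ ν ≤ wassersteinW1 (μ.map φ) (ν.map ψ) := by
  obtain ⟨h⟩ := ‹BorelSpace Z›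
  subst h
  exact iInf_le_of_le Z <| iInf_le_of_le _ <| iInf_le_of_le φ <| iInf_le_of_le ψ <|
    iInf_le_of_le hφ <| iInf_le _ hψ

/-- The characteristic property of the infimum: `c ≤ d_{GW₁}` as soon as `c` is below
`d^Z_{W₁}(φ_* μ, ψ_* ν)` for every metric space `Z` with its Borel σ-algebra and all isometric
embeddings `φ`, `ψ`. [cite: Bamler2023, §2.4, Definition (Gromov–W_p–Wasserstein distance)] -/
theorem le_gromovW1 {μ : Measure X} {ν : Measure Y} {c : ℝ≥0∞}
    (h : ∀ (Z : Type u) [MetricSpace Z] [MeasurableSpace Z] [BorelSpace Z] (φ : X → Z) (ψ : Y → Z),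
      Isometry φ → Isometry ψ → c ≤ wassersteinW1 (μ.map φ) (ν.map ψ)) :
    c ≤ gromovW1 μ ν := by
  refine le_iInf fun Z ↦ le_iInf fun _ ↦ le_iInf fun φ ↦ le_iInf fun ψ ↦ le_iInf fun hφ ↦
    le_iInf fun hψ ↦ ?_
  letI : MeasurableSpace Z := borel Z
  haveI : BorelSpace Z := ⟨rfl⟩
  exact h Z φ ψ hφ hψ

/-- **Symmetry of `d_{GW₁}`** (exchange the roles of the two embeddings; `d_{W₁}` is symmetric).
[cite: Bamler2023, §2.4, Proposition (d_{GW_p} is a pseudometric)] -/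
theorem gromovW1_comm (μ : Measure X) (ν : Measure Y) : gromovW1 μ ν = gromovW1 ν μ := by
  suffices h : ∀ {X' Y' : Type u} [MetricSpace X'] [MeasurableSpace X'] [MetricSpace Y']
      [MeasurableSpace Y'] (μ' : Measure X') (ν' : Measure Y'), gromovW1 ν' μ' ≤ gromovW1 μ' ν' from
    le_antisymm (h ν μ) (h μ ν)
  intro X' Y' _ _ _ _ μ' ν'
  refine le_gromovW1 fun Z _ _ _ φ ψ hφ hψ ↦ ?_
  rw [wassersteinW1_comm]
  exact gromovW1_le_wassersteinW1_map ν' μ' hψ hφ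

end Def

section SameSpace

variable {X : Type u} [MetricSpace X] [MeasurableSpace X] [BorelSpace X]

/-- `d_{GW₁}((X, μ), (X, ν)) ≤ d_{W₁}(μ, ν)` (take `Z = X` and the identity embeddings).
[cite: Bamler2023, §2.4, Definition (Gromov–W_p–Wasserstein distance)] -/
theorem gromovW1_le_wassersteinW1 (μ ν : Measure X) : gromovW1 μ ν ≤ wassersteinW1 μ ν := by
  have h := gromovW1_le_wassersteinW1_map μ ν (Z := X) isometry_id isometry_id
  rwa [Measure.map_id, Measure.map_id] at h

/-- **`d_{GW₁}((X, μ), (X, μ)) = 0`** for a probability measure on a separable metric space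
(`d_{W₁}(μ, μ) = 0`). [cite: Bamler2023, §2.4, Proposition (d_{GW_p} is a pseudometric)] -/
theorem gromovW1_self [SecondCountableTopology X] (μ : Measure X) [IsProbabilityMeasure μ] :
    gromovW1 μ μ = 0 :=
  le_antisymm ((gromovW1_le_wassersteinW1 μ μ).trans_eq (wassersteinW1_self μ)) bot_le

end SameSpace

section Isometry

variable {X X' Y : Type u} [MetricSpace X] [MeasurableSpace X] [BorelSpace X]
  [MetricSpace X'] [MeasurableSpace X'] [BorelSpace X'] [MetricSpace Y] [MeasurableSpace Y]

/-- **Monotonicity under an isometric embedding of the first space**: for an isometric embedding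
`f : X → X'`, `d_{GW₁}((X, μ), (Y, ν)) ≤ d_{GW₁}((X', f_* μ), (Y, ν))` — compose the embeddings
of `X'` with `f`. [cite: Bamler2023, §2.3 (isometries between metric measure spaces)] -/
theorem gromovW1_le_gromovW1_map {f : X → X'} (hf : Isometry f) (μ : Measure X) (ν : Measure Y) :
    gromovW1 μ ν ≤ gromovW1 (μ.map f) ν := by
  refine le_gromovW1 fun Z _ _ _ φ ψ hφ hψ ↦ ?_
  rw [Measure.map_map hφ.continuous.measurable hf.continuous.measurable]
  exact gromovW1_le_wassersteinW1_map μ ν (hφ.comp hf) hψ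

/-- **Isometric metric measure spaces have the same `d_{GW₁}`-distances** (Bamler 2023, §2.3: an
isometry of metric measure spaces is a metric isometry `f` with `f_* μ₁ = μ₂`): for a surjective
isometry `e : X ≃ᵢ X'`, `d_{GW₁}((X', e_* μ), (Y, ν)) = d_{GW₁}((X, μ), (Y, ν))`.
[cite: Bamler2023, §2.3 (isometries between metric measure spaces)] -/
theorem gromovW1_map_isometryEquiv (e : X ≃ᵢ X') (μ : Measure X) (ν : Measure Y) :
    gromovW1 (μ.map e) ν = gromovW1 μ ν := by
  refine le_antisymm ?_ (gromovW1_le_gromovW1_map e.isometry μ ν)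
  have h := gromovW1_le_gromovW1_map e.symm.isometry (μ.map e) ν
  rwa [Measure.map_map e.symm.continuous.measurable e.continuous.measurable,
    show (e.symm : X' → X) ∘ (e : X → X') = id from funext fun x ↦ e.symm_apply_apply x,
    Measure.map_id] at h

end Isometry

end Literature.Geometry.Riemannian

end
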